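import Summits.BirchSwinnertonDyer.Rank1Residual.X10.CoreTheoremAOddPrimeHolds
import HarnessLib

/-!
# N2 (class X10b, `p = 3`) and class X10 PER PAIR, MODULO KATO'S ZETA-ELEMENT PACKAGE F1 ALONE: the
# Euler-system half, Miller's `BSD(E,3)` at the `3 ∤ #Ш_an` pairs in BOTH ranks, X_A3 ⟺ `BSD(E,3)` at
# rank `0`, and the literal-model RECORD shapes — with the node `KatoMuTransferThree`, Kato's Thm. 17.4 at
# the pair AND the Mazur–Tate `σ` ALL discharged (cell `b2b-bsdres`, unit `b2b-bsdres-x10` = N2 class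
# lead, GEN 41; TOOL — theorems only, no definition, no named fact, nothing booked)

HONEST FRAMING (run/shared/lean/b2b/bsd-rank1-residual/, verbatim in every file): the goal of the
cell is to DELETE the COMBINATION-SHAPED residual classes of the Birch–Swinnerton-Dyer formula for
ALL analytic-rank `≤ 1` elliptic curves over `ℚ` — "full BSD formula for every rank `≤ 1` curve in
class `C`" assembled STRICTLY from published theorems — so that the rank-`≤ 1` remainder becomes
exactly the CONSTRUCTION-SHAPED classes, which are TYPED (missing-input `Prop`s), NOT attempted.
This is not "finishing BSD".  Class X10b (= N2) keeps its label CONSTRUCTION-SHAPED / NEEDS X_A3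
(RESIDUAL-MAP §I N2): the class-level X_A3 needs `AnalyticMuZeroOnClassX10b` (barrier B3, class-wide),
which only per-pair certificates supply.  Nothing is booked by this file; no census word and no mark
moves; everything below is PER PAIR.  PARTITION (D-0054): X10b∧¬Surj (A5) × p = 3 (and class X10 at
`3`, either image, for the class-free forms) — types-the-object-of; closes NONE.

## What (x10 GEN 41, X10-AUDIT §47)

GEN 35/36 wrote N2's per-pair layer — the Euler-system half `ord₃ #Ш ≤ ord₃ #Ш_an`, Miller's
`BSD(E,3)` at the `3 ∤ #Ш(E/ℚ)_an` pairs in both ranks, `MazurMainConjecture W 3 ↔ BSDp W 3` at rank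
`0`, and the literal-model record shapes — modulo the cell node `KatoMuTransferThree` (`hT3`), Kato's
Thm. 17.4 at the pair (`hK` / `hkato`), the Mazur–Tate `σ` at `3` (`hMT`) and published binders
(`X10/MuTransferThreeEulerHalf`, `…IntModel`, `…ShaAnUnit`, `…RankOneAnyImage`).  Since then all three
cell-side binders have become CONSEQUENCES in the tree of ONE published construction fact, F1 = Kato
2004 Thm. 12.5/12.6 with Ex. 13.3, (14.9.3), Prop. 17.11, §17.13
(`Kato2004.exists_divisibilityInputs_fineQuotient_zeta`; aside 19843 of rung K6, director-held):

* `hT3` — `X10.katoMuTransferThree_of_fine` (GEN 40, `X10/CoreTheoremAOddPrimeHolds`: the typed core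
  `CoreTheoremAOddPrime` is UNCONDITIONAL since F2 = Kato §13.8 and F3 = Poitou–Tate over `ℚ` are tree
  theorems);
* `hK` / `hkato` — Kato's Thm. 17.4 at EVERY cyclotomic datum from F1 with NO Thm. 12.4 binder
  (`col ∘ loc : 𝐇¹ ↪ Λ` is injective in the §17.13 package, so `𝐇¹` is torsion free of rank `≤ 1`):
  the observation of `Theorems.smallImageMuTransfer_kato_divisibility_of_fine` (cell `bsd-smallim`, k6-c2
  g6, p482919), re-proved as §0 below inside the X10 topic (that module imports the route file, which a
  cell-topic file should not pull in — `lint.theses-cone`);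
* `hMT` — `mazur_tate_sigma_exists_odd_holds` (sub-cell x1a, `PadicSigmaThreeExistence`).

THIS FILE substitutes the three and restates the layer with the binders that REMAIN: F1 (`hfine`);
PUBLISHED named facts `Schneider1985_order_charGenerator_odd` (`hS`),
`perrinRiou_rankOne_leadingTerms_odd` (`hPR`, rank `1` only), `nonempty_modularParametrizationData`
(`hmodP`), `rank_eq_analyticRank_of_analyticRank_le_one` (`hGZK`),
`realPeriodRat_eq_unit_mul_plusPeriod_three` (`h3`); finite per-pair certificates `hcertA` (one unit
coefficient of `L_3(f, α)`; 313/313 N2 cells on record, three engines,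
`class-closure/N2/MUCERT3-x10g36.tsv`), `hunit` (`3 ∤ #Ш_an`; 292/313), the Schneider certificate
`hSch` at rank `1` (rider I1); census data `hL` / `hr0` / `hr1`.  No separate Kato Thm. 17.4, no Thm.
12.4, no `σ`-fact, no Greenberg-4.1 fact, no rational main conjecture, no flag (Yan–Zhu unused).

§0 `kato_divisibility_of_fine` (the uniform `hkato` shape) / `kato_divisibility_three_of_fine` (the
per-curve `hK` shape at `3`).  §1 class-free: `mu_eq_zero_three_of_fine`,
`missingUpperBoundAt_three_of_fine`, `mazurMainConjecture_iff_bsdp_three_of_fine`,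
`bsdp_three_of_fine_of_shaAn_unit`.  §2 N2 / class X10 at rank `0`: `divisibility_three_of_fine`,
`missingUpperBoundAt_three_rankZero_of_fine[_anyImage]`,
`mazurMainConjecture_iff_bsdp_three_rankZero_of_fine[_anyImage]`,
`mazurMainConjecture_three_rankZero_of_fine_of_bsdp`, `bsdp_three_rankZero_of_fine_of_shaAn_unit[_anyImage]`.
The rank-`1` forms, the both-ranks N2 / class-X10 statements and the literal-model RECORD shapes are
the companion file `X10/MuTransferThreeOfFineBothRanks.lean` (same GEN).

READING for N2 (evidence; no label moves): per pair and flag-free, `BSD(E,3)` at the 292 N2 cells with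
`3 ∤ #Ш_an`, the Euler-system half at all 313, and X_A3 at the rank-`0` cells given the booked
`BSD(E,3)`, rest on EXACTLY ONE cell-external open input — the published construction fact F1 — plus
refereed-in-print named facts and finite certificates (+ the Schneider rider at rank `1`).

References: K. Kato, Astérisque 295 (2004) Thm. 12.5, Thm. 12.6 (p. 222), Ex. 13.3, §13.8, (14.9.3),
Thm. 17.4 (p. 273), Prop. 17.11, §17.13 (pp. 279–280) [Kato2004Asterisque]; R. Greenberg, LNM 1716
(1999) Conj. 1.11, Thm. 4.1 [GreenbergLNM1716]; R. Greenberg, V. Vatsal, Invent. Math. 142 (2000)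
(1)–(2), Prop. 3.7, Rem. 3.4 [GreenbergVatsal2000]; B. Perrin-Riou, Bull. SMF 115 (1987) §1.4 Cor. 1.8
[PerrinRiou1987]; J. Balakrishnan, J. S. Müller, W. Stein, Math. Comp. 85 (2016) Thm. 1.7
[BalakrishnanMullerStein2015]; C. Wuthrich, Doc. Math. 19 (2014) Lemma 20, Prop. 21 [Wuthrich2014];
B. Mazur, Invent. Math. 44 (1978) Prop. 6.3 (1) [Mazur1978]; R. L. Miller, LMS J. Comput. Math. 14
(2011) Def. 1.1 [Miller2011LMS]; cell files X10-AUDIT.md §40–§47.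
-/

set_option autoImplicit false

noncomputable section

open scoped Classical MatrixGroups ModularForm

open CongruenceSubgroup WeierstrassCurve Field Literature.NumberTheory.GaloisRepresentations
  Literature.NumberTheory.GaloisCohomology Literature.NumberTheory.EllipticCurves
  Literature.NumberTheory.EllipticCurves.ModularForms Literature.NumberTheory.EllipticCurves.Rank1Residual
  Literature.NumberTheory.EllipticCurves.Rank1Residual.Typed
  Literature.NumberTheory.EllipticCurves.Wuthrich2014
  Literature.NumberTheory.EllipticCurves.Kato2004 Literature.NumberTheory.EllipticCurves.Kato2004.EulerSystemValues
  Literature.NumberTheory.EllipticCurves.Rank1Residual.X11RankOneCertificates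
  Summit.BirchSwinnertonDyer.BirchSwinnertonDyer.Rank1Residual.IntModel
  Summit.BirchSwinnertonDyer.BirchSwinnertonDyer.Rank1Residual.X11RankOne
  Summit.BirchSwinnertonDyer.BirchSwinnertonDyer.Theorems.Rank1ResidualX1Defs
  Summit.BirchSwinnertonDyer.BirchSwinnertonDyer.Rank1Residual

namespace Summit.BirchSwinnertonDyer.Rank1Residual.X10

/-! ### §0. Kato's Thm. 17.4 at the pair from F1 (the two binder shapes of the N2 files) -/

/-- **Kato's Thm. 17.4 for `T_pE` at EVERY pair, cyclotomic datum, level and newform — the uniform binder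
shape `hkato` of the N2 record files — from F1 alone.**  `Kato2004.kato_divisibility_of_inputs` composed the
PROVED §17.13 module theory `kato_divisibility_body_of_skeleton` with three facts: (12.2.1) datum existence
(the tree theorem `nonempty_iwasawaH1Data_holds`), the §17.13 package (from F1, GEN 40's
`exists_divisibilityInputs_of_fineQuotient_zeta`) and Kato's Thm. 12.4 (2) (`𝐇¹` torsion free of rank
`≤ 1`).  The last is READ OFF the package: `loc : 𝐇¹ → P` is injective ((17.13.2)) and the Coleman map
`col : P → Λ` is injective (Prop. 17.11), so `col ∘ loc : 𝐇¹ ↪ Λ` makes `𝐇¹` torsion free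
(`Function.Injective.moduleIsTorsionFree`) of rank `≤ rank Λ = 1` (`LinearMap.rank_le_of_injective`).
This is the argument of `Theorems.smallImageMuTransfer_kato_divisibility_of_fine` (cell `bsd-smallim`,
k6-c2 g6, p482919), restated here so that the X10 topic stays independent of the route file
`Theses/SmallImageMuTransfer` (that module imports it; `lint.theses-cone`).  Conditional on F1 only;
nothing asserted. [cite: Kato2004Asterisque, Thm. 12.5 (4), Thm. 12.6 (p. 222), Thm. 17.4 (p. 273), Prop. 17.11 (p. 277) and §17.13 (pp. 279–280)] -/
theorem kato_divisibility_of_fine (hfine : exists_divisibilityInputs_fineQuotient_zeta) :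
    ∀ (W : WeierstrassCurve ℚ) [W.IsElliptic] [W.IsGloballyMinimal] (p : ℕ) [Fact p.Prime]
      (κ : ZpExtension ℚ p) (γ : Field.absoluteGaloisGroup ℚ) (N : ℕ) [NeZero N]
      (f : CuspForm (Gamma0 N) 2), kato_divisibility W p (κ := κ) (γ := γ) (f := f) := by
  intro W _ _ p _ κ γ N _ f hp hord hκ hγ hγ' hf D
  haveI : ContinuousSMul ℤ_[p] (W.tateModule p) := TateModule.continuousSMul_padicInt
  obtain ⟨I⟩ := nonempty_iwasawaH1Data_holds W p κ γ hκ hγ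
  obtain ⟨K⟩ := exists_divisibilityInputs_of_fineQuotient_zeta hfine W p f κ γ hp hord hκ hγ hγ' hf I D
  -- Thm. 12.4 (2) for free: `col ∘ loc : 𝐇¹ ↪ Λ`
  have hinj : Function.Injective (K.col ∘ₗ K.loc) := K.col_injective.comp K.loc_injective
  haveI : Module.IsTorsionFree (IwasawaAlgebra p) I.H :=
    Function.Injective.moduleIsTorsionFree (K.col ∘ₗ K.loc) hinj fun r m ↦ map_smul _ r m
  have hrank : Module.rank (IwasawaAlgebra p) I.H ≤ 1 :=
    (LinearMap.rank_le_of_injective _ hinj).trans_eq (Module.rank_self _)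
  haveI := K.finite_H2loc
  exact kato_divisibility_body_of_skeleton W p hord hf hκ hγ D hrank K.loc K.toX K.δ K.exact_P
    K.exact_X K.col K.col_injective K.isTorsion_H2 K.Z K.pow_mem K.es_bound
    (fun 𝔭 _ hp𝔭 ↦ lengthAt_eq_zero_of_finite_of_C_not_mem K.H2loc 𝔭 hp𝔭) K.ιG_eq K.integral

/-- **Kato's Thm. 17.4 at `(E, 3)` for the newforms of level `N_E` — the per-curve binder shape `hK` of
the N2 tool files — from F1 alone.** [cite: Kato2004Asterisque, Thm. 17.4 (p. 273) and §17.13 (pp. 279–280)] -/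
theorem kato_divisibility_three_of_fine (hfine : exists_divisibilityInputs_fineQuotient_zeta)
    (W : WeierstrassCurve ℚ) [W.IsElliptic] [W.IsGloballyMinimal] :
    ∀ (κ : ZpExtension ℚ 3) (γ : Field.absoluteGaloisGroup ℚ) [NeZero (W.conductorNorm ℤ)]
      (f : CuspForm (Gamma0 (W.conductorNorm ℤ)) 2), kato_divisibility W 3 (κ := κ) (γ := γ) (f := f) :=
  fun κ γ _ f ↦ kato_divisibility_of_fine hfine W 3 κ γ (W.conductorNorm ℤ) f

/-! ### §1. Class-free forms at `p = 3` (good ordinary, `E[3]` irreducible), modulo F1 -/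

section ClassFree

variable (W : WeierstrassCurve ℚ) [W.IsElliptic] [W.IsGloballyMinimal]

/-- **The `μ`-transfer at a pair from F1**: `3` good ordinary, `E[3]` irreducible, `ρ̄_{E,3}` NOT
surjective, one unit coefficient of `L_3(f, α)` for the newforms of `W` ⟹ `μ(X) = 0` for every
cyclotomic datum at `3` (GEN 35's `mu_eq_zero_three_of_katoMuTransferThree` with the node supplied by
`katoMuTransferThree_of_fine`). [cite: Kato2004Asterisque, Thm. 12.6 (p. 222), §13.8 (p. 228) and §17.13 (pp. 279–280)]
[cite: GreenbergVatsal2000, Prop. 3.7] -/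
theorem mu_eq_zero_three_of_fine (hfine : exists_divisibilityInputs_fineQuotient_zeta)
    (hmodP : nonempty_modularParametrizationData)
    (hgood : W.HasGoodReductionAtPrime 3) (hord : ¬ ((3 : ℕ) : ℤ) ∣ W.frobeniusTrace 3)
    (hirr : W.HasIrreducibleModPGaloisRep 3) (hns : ¬ Surj W 3)
    (hcertA : ∀ {N : ℕ} [NeZero N] (f : CuspForm (Gamma0 N) 2), IsNewformOf W f →
      ∃ n : ℕ, ‖PowerSeries.coeff n (padicLFunction f (unitRoot W 3 : ℚ_[3]))‖ = 1) :
    ∀ (κ : ZpExtension ℚ 3) (γ : Field.absoluteGaloisGroup ℚ),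
      κ.IsCyclotomic → κ.IsTopGenerator γ → IsCyclotomicVariable 3 γ →
      ∀ D : W.SelmerDualData κ γ, D.mu = 0 :=
  mu_eq_zero_three_of_katoMuTransferThree W hmodP (katoMuTransferThree_of_fine hfine) hgood hord hirr hns
    hcertA

/-- **`3` good ordinary, `E[3]` irreducible, `L(E,1) ≠ 0`, EITHER image: F1 ∧ certificate ⟹ the
Euler-system half `ord₃ #Ш(E/ℚ) ≤ ord₃ #Ш(E/ℚ)_an`** (`Typed.MissingUpperBoundAt W 3`) — GEN 35's
`missingUpperBoundAt_three_of_katoMuTransferThree` with `hT3`, `hK`, `hMT` discharged (surjective image: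
Kato (3) on the good-ordinary tower; otherwise Kato (2) + the transfer's `μ = 0`).
[cite: Kato2004Asterisque, Thm. 17.4 (2), (3) (p. 273) and §17.13 (pp. 279–280)]
[cite: GreenbergLNM1716, §1 Conj. 1.11 and Thm. 4.1 (p. 102)] [cite: Wuthrich2014, Lemma 20 (p. 399) and Prop. 21 (p. 400)] -/
theorem missingUpperBoundAt_three_of_fine (hfine : exists_divisibilityInputs_fineQuotient_zeta)
    (hS : Schneider1985_order_charGenerator_odd) (hmodP : nonempty_modularParametrizationData)
    (hGZK : rank_eq_analyticRank_of_analyticRank_le_one)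
    (h3 : realPeriodRat_eq_unit_mul_plusPeriod_three)
    (hgood : W.HasGoodReductionAtPrime 3) (hord : ¬ ((3 : ℕ) : ℤ) ∣ W.frobeniusTrace 3)
    (hirr : W.HasIrreducibleModPGaloisRep 3) (hL : W.entireLFunction 1 ≠ 0)
    (hcertA : ∀ {N : ℕ} [NeZero N] (f : CuspForm (Gamma0 N) 2), IsNewformOf W f →
      ∃ n : ℕ, ‖PowerSeries.coeff n (padicLFunction f (unitRoot W 3 : ℚ_[3]))‖ = 1) :
    Typed.MissingUpperBoundAt W 3 :=
  missingUpperBoundAt_three_of_katoMuTransferThree W hS mazur_tate_sigma_exists_odd_holds hmodP hGZK h3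
    (katoMuTransferThree_of_fine hfine) (kato_divisibility_three_of_fine hfine W) hgood hord hirr hL hcertA

/-- **`3` good ordinary, `E[3]` irreducible, `L(E,1) ≠ 0`, EITHER image: under F1 ∧ certificate, X_A3 at
the pair ⟺ Miller's `BSD(E,3)`** (`MazurMainConjecture W 3 ↔ BSDp W 3`) — GEN 35's
`mazurMainConjecture_iff_bsdp_three_of_katoMuTransferThree` with `hT3`, `hK`, `hMT` discharged.
[cite: Kato2004Asterisque, Thm. 17.4 (2), (3) (p. 273) and §17.13 (pp. 279–280)]
[cite: GreenbergLNM1716, §1 Conj. 1.11, Thm. 4.1 and §5] [cite: Miller2011LMS, Def. 1.1 (arXiv:1010.2431 p. 3)] -/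
theorem mazurMainConjecture_iff_bsdp_three_of_fine (hfine : exists_divisibilityInputs_fineQuotient_zeta)
    (hS : Schneider1985_order_charGenerator_odd) (hmodP : nonempty_modularParametrizationData)
    (hGZK : rank_eq_analyticRank_of_analyticRank_le_one)
    (h3 : realPeriodRat_eq_unit_mul_plusPeriod_three)
    (hgood : W.HasGoodReductionAtPrime 3) (hord : ¬ ((3 : ℕ) : ℤ) ∣ W.frobeniusTrace 3)
    (hirr : W.HasIrreducibleModPGaloisRep 3) (hL : W.entireLFunction 1 ≠ 0)
    (hcertA : ∀ {N : ℕ} [NeZero N] (f : CuspForm (Gamma0 N) 2), IsNewformOf W f →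
      ∃ n : ℕ, ‖PowerSeries.coeff n (padicLFunction f (unitRoot W 3 : ℚ_[3]))‖ = 1) :
    MazurMainConjecture W 3 ↔ BSDp W 3 :=
  mazurMainConjecture_iff_bsdp_three_of_katoMuTransferThree W hS mazur_tate_sigma_exists_odd_holds hmodP
    hGZK h3 (katoMuTransferThree_of_fine hfine) (kato_divisibility_three_of_fine hfine W) hgood hord hirr
    hL hcertA

/-- **`3` good ordinary, `E[3]` irreducible, `L(E,1) ≠ 0`, EITHER image, at a pair with
`ord₃ #Ш(E/ℚ)_an = 0`: F1 ∧ the two finite certificates ⟹ Miller's `BSD(E,3)`** — GEN 36's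
`bsdp_three_of_katoMuTransferThree_of_shaAn_unit` with `hT3`, `hK`, `hMT` discharged.  Binders left: F1;
PUBLISHED `hS`, `hmodP`, `hGZK`, `h3`; certificates `hcertA`, `hunit`; datum `hL`.  Nothing booked.
[cite: Kato2004Asterisque, Thm. 17.4 (2), (3) (p. 273) and §17.13 (pp. 279–280)]
[cite: GreenbergLNM1716, §1 Conj. 1.11 and Thm. 4.1 (p. 102)] [cite: Miller2011LMS, Def. 1.1 (arXiv:1010.2431 p. 3)] -/
theorem bsdp_three_of_fine_of_shaAn_unit (hfine : exists_divisibilityInputs_fineQuotient_zeta)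
    (hS : Schneider1985_order_charGenerator_odd) (hmodP : nonempty_modularParametrizationData)
    (hGZK : rank_eq_analyticRank_of_analyticRank_le_one)
    (h3 : realPeriodRat_eq_unit_mul_plusPeriod_three)
    (hgood : W.HasGoodReductionAtPrime 3) (hord : ¬ ((3 : ℕ) : ℤ) ∣ W.frobeniusTrace 3)
    (hirr : W.HasIrreducibleModPGaloisRep 3) (hL : W.entireLFunction 1 ≠ 0)
    (hcertA : ∀ {N : ℕ} [NeZero N] (f : CuspForm (Gamma0 N) 2), IsNewformOf W f →
      ∃ n : ℕ, ‖PowerSeries.coeff n (padicLFunction f (unitRoot W 3 : ℚ_[3]))‖ = 1)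
    (hunit : ∃ q : ℚ, shaAn W = (q : ℂ) ∧ padicValRat 3 q = 0) : BSDp W 3 :=
  bsdp_three_of_katoMuTransferThree_of_shaAn_unit W hS mazur_tate_sigma_exists_odd_holds hmodP hGZK h3
    (katoMuTransferThree_of_fine hfine) (kato_divisibility_three_of_fine hfine W) hgood hord hirr hL hcertA
    hunit

end ClassFree

/-! ### §2. N2 and class X10 at rank `0`, modulo F1 -/

section RankZero

variable (W : WeierstrassCurve ℚ) [W.IsElliptic] [W.IsGloballyMinimal]

/-- **N2, any rank: F1 ∧ one unit coefficient of `L_3(f, α)` ⟹ the Néron-normalised INTEGRAL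
divisibility datum at `(E,3)`** — for every cyclotomic `(κ, γ)`, the newform `f` of level `N_E`, the
period ratio `ϖ` and every dual datum `D`: `X` is `Λ`-torsion and some `g ∈ char_Λ X` has
`ι g = ϖ · L_3(f, α)` (GEN 35's `divisibility_three_of_katoMuTransferThree` with `hT3`, `hK` discharged).
[cite: Kato2004Asterisque, Thm. 17.4 (2) (p. 273) and §17.13 (pp. 279–280)]
[cite: GreenbergVatsal2000, p. 2 (1)–(2), Prop. (3.7) and §3 Remark (3.4)] -/
theorem divisibility_three_of_fine (hfine : exists_divisibilityInputs_fineQuotient_zeta)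
    (hmodP : nonempty_modularParametrizationData) (h3 : realPeriodRat_eq_unit_mul_plusPeriod_three)
    (hX : ClassX10 W 3) (hns : ¬ Surj W 3)
    (hcertA : ∀ {N : ℕ} [NeZero N] (f : CuspForm (Gamma0 N) 2), IsNewformOf W f →
      ∃ n : ℕ, ‖PowerSeries.coeff n (padicLFunction f (unitRoot W 3 : ℚ_[3]))‖ = 1) :
    ∀ (κ : ZpExtension ℚ 3) (γ : Field.absoluteGaloisGroup ℚ),
        κ.IsCyclotomic → κ.IsTopGenerator γ → IsCyclotomicVariable 3 γ →
      ∀ [NeZero (W.conductorNorm ℤ)] (f : CuspForm (Gamma0 (W.conductorNorm ℤ)) 2),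
        IsNewformOf W f → ∀ (ϖ : ℚ), (ϖ : ℝ) * W.realPeriodRat = plusPeriod f →
      ∀ (D : W.SelmerDualData κ γ), D.IsTorsion ∧
        ∃ g ∈ D.charIdeal, iwasawaToPowerSeries 3 g =
          PowerSeries.C (ϖ : ℚ_[3]) * padicLFunction f (unitRoot W 3 : ℚ_[3]) :=
  divisibility_three_of_katoMuTransferThree W hmodP h3 (katoMuTransferThree_of_fine hfine)
    (kato_divisibility_three_of_fine hfine W) hX hns hcertA

/-- **N2 ∩ {r = 0}: F1 ∧ certificate ⟹ the Euler-system half `ord₃ #Ш(E/ℚ) ≤ ord₃ #Ш(E/ℚ)_an`**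
(GEN 35's `missingUpperBoundAt_three_rankZero_of_katoMuTransferThree`, `hT3`/`hK`/`hMT` discharged).
[cite: Kato2004Asterisque, Thm. 17.4 (2) (p. 273) and §17.13 (pp. 279–280)]
[cite: GreenbergLNM1716, §1 Conj. 1.11 and Thm. 4.1 (p. 102)] -/
theorem missingUpperBoundAt_three_rankZero_of_fine (hfine : exists_divisibilityInputs_fineQuotient_zeta)
    (hS : Schneider1985_order_charGenerator_odd) (hmodP : nonempty_modularParametrizationData)
    (hGZK : rank_eq_analyticRank_of_analyticRank_le_one)
    (h3 : realPeriodRat_eq_unit_mul_plusPeriod_three)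
    (hX : ClassX10 W 3) (hns : ¬ Surj W 3) (hr0 : W.analyticRank = 0)
    (hcertA : ∀ {N : ℕ} [NeZero N] (f : CuspForm (Gamma0 N) 2), IsNewformOf W f →
      ∃ n : ℕ, ‖PowerSeries.coeff n (padicLFunction f (unitRoot W 3 : ℚ_[3]))‖ = 1) :
    Typed.MissingUpperBoundAt W 3 :=
  missingUpperBoundAt_three_rankZero_of_katoMuTransferThree W hS mazur_tate_sigma_exists_odd_holds hmodP
    hGZK h3 (katoMuTransferThree_of_fine hfine) (kato_divisibility_three_of_fine hfine W) hX hns hr0 hcertA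

/-- **Class X10 ∩ {r = 0}, EITHER mod-`3` image: F1 ∧ certificate ⟹ the Euler-system half** (GEN 35's
`missingUpperBoundAt_three_rankZero_of_katoMuTransferThree_anyImage`, `hT3`/`hK`/`hMT` discharged;
surjective image: the good-ordinary tower + Kato (3), certificate idle).
[cite: Kato2004Asterisque, Thm. 17.4 (2), (3) (p. 273) and §17.13 (pp. 279–280)] [cite: Wuthrich2014, Lemma 20 (p. 399)] -/
theorem missingUpperBoundAt_three_rankZero_of_fine_anyImage
    (hfine : exists_divisibilityInputs_fineQuotient_zeta)
    (hS : Schneider1985_order_charGenerator_odd) (hmodP : nonempty_modularParametrizationData)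
    (hGZK : rank_eq_analyticRank_of_analyticRank_le_one)
    (h3 : realPeriodRat_eq_unit_mul_plusPeriod_three)
    (hX : ClassX10 W 3) (hr0 : W.analyticRank = 0)
    (hcertA : ∀ {N : ℕ} [NeZero N] (f : CuspForm (Gamma0 N) 2), IsNewformOf W f →
      ∃ n : ℕ, ‖PowerSeries.coeff n (padicLFunction f (unitRoot W 3 : ℚ_[3]))‖ = 1) :
    Typed.MissingUpperBoundAt W 3 :=
  missingUpperBoundAt_three_rankZero_of_katoMuTransferThree_anyImage W hS mazur_tate_sigma_exists_odd_holds
    hmodP hGZK h3 (katoMuTransferThree_of_fine hfine) (kato_divisibility_three_of_fine hfine W) hX hr0 hcertA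

/-- **N2 ∩ {r = 0}: under F1 ∧ certificate, X_A3 at the pair ⟺ `BSD(E,3)`** (GEN 35's
`mazurMainConjecture_iff_bsdp_three_rankZero_of_katoMuTransferThree`, `hT3`/`hK`/`hMT` discharged).
[cite: Kato2004Asterisque, Thm. 17.4 (2) (p. 273) and §17.13 (pp. 279–280)]
[cite: GreenbergLNM1716, §1 Conj. 1.11, Thm. 4.1 (p. 102) and §5] [cite: Miller2011LMS, Def. 1.1 (arXiv:1010.2431 p. 3)] -/
theorem mazurMainConjecture_iff_bsdp_three_rankZero_of_fine
    (hfine : exists_divisibilityInputs_fineQuotient_zeta)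
    (hS : Schneider1985_order_charGenerator_odd) (hmodP : nonempty_modularParametrizationData)
    (hGZK : rank_eq_analyticRank_of_analyticRank_le_one)
    (h3 : realPeriodRat_eq_unit_mul_plusPeriod_three)
    (hX : ClassX10 W 3) (hns : ¬ Surj W 3) (hr0 : W.analyticRank = 0)
    (hcertA : ∀ {N : ℕ} [NeZero N] (f : CuspForm (Gamma0 N) 2), IsNewformOf W f →
      ∃ n : ℕ, ‖PowerSeries.coeff n (padicLFunction f (unitRoot W 3 : ℚ_[3]))‖ = 1) :
    MazurMainConjecture W 3 ↔ BSDp W 3 :=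
  mazurMainConjecture_iff_bsdp_three_rankZero_of_katoMuTransferThree W hS mazur_tate_sigma_exists_odd_holds
    hmodP hGZK h3 (katoMuTransferThree_of_fine hfine) (kato_divisibility_three_of_fine hfine W) hX hns hr0
    hcertA

/-- **Class X10 ∩ {r = 0}, EITHER image: under F1 ∧ certificate, `MazurMainConjecture W 3 ↔ BSDp W 3`**
(GEN 35's `…_anyImage` form, `hT3`/`hK`/`hMT` discharged).
[cite: Kato2004Asterisque, Thm. 17.4 (2), (3) (p. 273) and §17.13 (pp. 279–280)] [cite: Wuthrich2014, Lemma 20 (p. 399)] -/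
theorem mazurMainConjecture_iff_bsdp_three_rankZero_of_fine_anyImage
    (hfine : exists_divisibilityInputs_fineQuotient_zeta)
    (hS : Schneider1985_order_charGenerator_odd) (hmodP : nonempty_modularParametrizationData)
    (hGZK : rank_eq_analyticRank_of_analyticRank_le_one)
    (h3 : realPeriodRat_eq_unit_mul_plusPeriod_three)
    (hX : ClassX10 W 3) (hr0 : W.analyticRank = 0)
    (hcertA : ∀ {N : ℕ} [NeZero N] (f : CuspForm (Gamma0 N) 2), IsNewformOf W f →
      ∃ n : ℕ, ‖PowerSeries.coeff n (padicLFunction f (unitRoot W 3 : ℚ_[3]))‖ = 1) :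
    MazurMainConjecture W 3 ↔ BSDp W 3 :=
  mazurMainConjecture_iff_bsdp_three_rankZero_of_katoMuTransferThree_anyImage W hS
    mazur_tate_sigma_exists_odd_holds hmodP hGZK h3 (katoMuTransferThree_of_fine hfine)
    (kato_divisibility_three_of_fine hfine W) hX hr0 hcertA

/-- **N2 ∩ {r = 0}, the road to X_A3 AT THE PAIR: F1 ∧ certificate ∧ the booked `BSD(E,3)` ⟹
`MazurMainConjecture W 3`** (GEN 35's `mazurMainConjecture_three_rankZero_of_katoMuTransferThree_of_bsdp`,
`hT3`/`hK`/`hMT` discharged).  Per pair; the class label does not move.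
[cite: Kato2004Asterisque, Thm. 17.4 (2) (p. 273) and §17.13 (pp. 279–280)] [cite: GreenbergLNM1716, §1 Conj. 1.11 and §5] -/
theorem mazurMainConjecture_three_rankZero_of_fine_of_bsdp
    (hfine : exists_divisibilityInputs_fineQuotient_zeta)
    (hS : Schneider1985_order_charGenerator_odd) (hmodP : nonempty_modularParametrizationData)
    (hGZK : rank_eq_analyticRank_of_analyticRank_le_one)
    (h3 : realPeriodRat_eq_unit_mul_plusPeriod_three)
    (hX : ClassX10 W 3) (hns : ¬ Surj W 3) (hr0 : W.analyticRank = 0)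
    (hcertA : ∀ {N : ℕ} [NeZero N] (f : CuspForm (Gamma0 N) 2), IsNewformOf W f →
      ∃ n : ℕ, ‖PowerSeries.coeff n (padicLFunction f (unitRoot W 3 : ℚ_[3]))‖ = 1)
    (hbsd : BSDp W 3) : MazurMainConjecture W 3 :=
  mazurMainConjecture_three_rankZero_of_katoMuTransferThree_of_bsdp W hS mazur_tate_sigma_exists_odd_holds
    hmodP hGZK h3 (katoMuTransferThree_of_fine hfine) (kato_divisibility_three_of_fine hfine W) hX hns hr0
    hcertA hbsd

/-- **N2 ∩ {r = 0} at a pair with `ord₃ #Ш(E/ℚ)_an = 0`: F1 ∧ the two certificates ⟹ Miller's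
`BSD(E,3)`** (GEN 36's `bsdp_three_rankZero_of_katoMuTransferThree_of_shaAn_unit`, `hT3`/`hK`/`hMT`
discharged).  Binders left: F1; PUBLISHED `hS`, `hmodP`, `hGZK`, `h3`; certificates `hcertA`, `hunit`.
[cite: Kato2004Asterisque, Thm. 17.4 (2) (p. 273) and §17.13 (pp. 279–280)]
[cite: GreenbergLNM1716, §1 Conj. 1.11 and Thm. 4.1 (p. 102)] [cite: Miller2011LMS, Def. 1.1 (arXiv:1010.2431 p. 3)] -/
theorem bsdp_three_rankZero_of_fine_of_shaAn_unit (hfine : exists_divisibilityInputs_fineQuotient_zeta)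
    (hS : Schneider1985_order_charGenerator_odd) (hmodP : nonempty_modularParametrizationData)
    (hGZK : rank_eq_analyticRank_of_analyticRank_le_one)
    (h3 : realPeriodRat_eq_unit_mul_plusPeriod_three)
    (hX : ClassX10 W 3) (hns : ¬ Surj W 3) (hr0 : W.analyticRank = 0)
    (hcertA : ∀ {N : ℕ} [NeZero N] (f : CuspForm (Gamma0 N) 2), IsNewformOf W f →
      ∃ n : ℕ, ‖PowerSeries.coeff n (padicLFunction f (unitRoot W 3 : ℚ_[3]))‖ = 1)
    (hunit : ∃ q : ℚ, shaAn W = (q : ℂ) ∧ padicValRat 3 q = 0) : BSDp W 3 :=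
  bsdp_three_rankZero_of_katoMuTransferThree_of_shaAn_unit W hS mazur_tate_sigma_exists_odd_holds hmodP
    hGZK h3 (katoMuTransferThree_of_fine hfine) (kato_divisibility_three_of_fine hfine W) hX hns hr0 hcertA
    hunit

/-- **Class X10 ∩ {r = 0}, EITHER image, at a pair with `ord₃ #Ш(E/ℚ)_an = 0`: F1 ∧ the certificates ⟹
Miller's `BSD(E,3)`** (GEN 36's `…_anyImage` form, `hT3`/`hK`/`hMT` discharged).
[cite: Kato2004Asterisque, Thm. 17.4 (2), (3) (p. 273) and §17.13 (pp. 279–280)] [cite: Wuthrich2014, Lemma 20 (p. 399)]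
[cite: Miller2011LMS, Def. 1.1 (arXiv:1010.2431 p. 3)] -/
theorem bsdp_three_rankZero_of_fine_of_shaAn_unit_anyImage
    (hfine : exists_divisibilityInputs_fineQuotient_zeta)
    (hS : Schneider1985_order_charGenerator_odd) (hmodP : nonempty_modularParametrizationData)
    (hGZK : rank_eq_analyticRank_of_analyticRank_le_one)
    (h3 : realPeriodRat_eq_unit_mul_plusPeriod_three)
    (hX : ClassX10 W 3) (hr0 : W.analyticRank = 0)
    (hcertA : ∀ {N : ℕ} [NeZero N] (f : CuspForm (Gamma0 N) 2), IsNewformOf W f →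
      ∃ n : ℕ, ‖PowerSeries.coeff n (padicLFunction f (unitRoot W 3 : ℚ_[3]))‖ = 1)
    (hunit : ∃ q : ℚ, shaAn W = (q : ℂ) ∧ padicValRat 3 q = 0) : BSDp W 3 :=
  bsdp_three_rankZero_of_katoMuTransferThree_of_shaAn_unit_anyImage W hS mazur_tate_sigma_exists_odd_holds
    hmodP hGZK h3 (katoMuTransferThree_of_fine hfine) (kato_divisibility_three_of_fine hfine W) hX hr0
    hcertA hunit

end RankZero


end Summit.BirchSwinnertonDyer.Rank1Residual.X10

end
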